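import Mathlib

/-!
# `SnSubsetDichotomy.ThresholdSubsetTriples`, line `SketchIdeator2` — stub `stub_twistFree_of_blocked`, explicit form

Crux `stmt-MatrixMultiplication-10882`
(`Summit.MatrixMultiplication.MatrixMultiplication.Theses.SnSubsetDichotomy.ThresholdSubsetTriples`),
line `SketchIdeator2` (ℤ/3-triality: triples `(X, τXτ⁻¹, τ²Xτ⁻²)` with `τ³ = 1`), registered stub
`stub_twistFree_of_blocked`.

Statement.  If every solution in `K⁶` of the twisted corner equation
`x₁x₁'⁻¹ τ (x₂x₂'⁻¹) τ (x₃x₃'⁻¹) τ = 1` is either trivial (`xᵢ = xᵢ'` for `i = 1, 2, 3`) or has a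
non-trivial quotient `xᵢxᵢ'⁻¹` in the blocking set `B`, and the sub-code `X ⊆ K` avoids `B` as a
quotient (`x x'⁻¹ ∈ B ⇒ x = x'` for `x, x' ∈ X`), then every solution in `X⁶` is trivial.

Proof (explicit, elementary; two named steps and a one-term assembly).
* `not_blocked_of_avoids` — on a set `X` avoiding `B` as a quotient, a "blocked" alternative
  `x x'⁻¹ ∈ B ∧ x ≠ x'` with `x, x' ∈ X` is impossible (the first conjunct forces `x = x'`).
* `blocked_restrict` — the host alternative is monotone in the host: it restricts from `K` to any
  `X ⊆ K` verbatim.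
* `stub_twistFree_of_blocked` — restrict the host alternative to `X`, then discard its three blocked
  branches with `Or.resolve_right` and `not_or`, using `not_blocked_of_avoids` at each coordinate.

No case analysis tactic, no decision procedure: the proof term is the composition of the two steps.
Independent proofs of the same registered signature live in the sibling files
`SnSubsetDichotomyThresholdSubsetTriplesStubTwistFreeOfBlocked.lean` (tactic case split) and
`SnSubsetDichotomyThresholdSubsetTriplesStubTwistFreeOfBlockedK12.lean` (decided Boolean core); this
file lives in the sub-namespace `TwistFreeOfBlockedK18` and imports neither.  Deliberately NOT here:
the host design (`stub_blockedHosts`), the Cayley deletion step, the TPP transfer — other stubs of the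
line.
-/

namespace Summit.MatrixMultiplication.MatrixMultiplication.Theorems.ThresholdSubsetTriples.TwistFreeOfBlockedK18

/-- **Avoidance kills a blocked branch.**  If `X` avoids `B` as a quotient
(`x x'⁻¹ ∈ B → x = x'` for all `x, x' ∈ X`), then for `x, x' ∈ X` the blocked alternative
`x x'⁻¹ ∈ B ∧ x ≠ x'` is false: its first conjunct gives `x = x'` by avoidance, contradicting the
second. [folklore] -/
theorem not_blocked_of_avoids {α : Type*} [Mul α] [Inv α] {B X : Finset α}
    (hA : ∀ x ∈ X, ∀ x' ∈ X, x * x'⁻¹ ∈ B → x = x') {x x' : α} (hx : x ∈ X) (hx' : x' ∈ X) :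
    ¬(x * x'⁻¹ ∈ B ∧ x ≠ x') :=
  fun h => h.2 (hA x hx x' hx' h.1)

/-- **The host alternative restricts to sub-codes.**  A property quantified over six elements of a
host `K` holds verbatim over six elements of any `X ⊆ K`. [folklore] -/
theorem blocked_restrict {α : Type*} {K X : Finset α} {P : α → α → α → α → α → α → Prop}
    (hXK : X ⊆ K)
    (hK : ∀ x₁ ∈ K, ∀ x₁' ∈ K, ∀ x₂ ∈ K, ∀ x₂' ∈ K, ∀ x₃ ∈ K, ∀ x₃' ∈ K, P x₁ x₁' x₂ x₂' x₃ x₃') :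
    ∀ x₁ ∈ X, ∀ x₁' ∈ X, ∀ x₂ ∈ X, ∀ x₂' ∈ X, ∀ x₃ ∈ X, ∀ x₃' ∈ X, P x₁ x₁' x₂ x₂' x₃ x₃' :=
  fun x₁ h₁ x₁' h₁' x₂ h₂ x₂' h₂' x₃ h₃ x₃' h₃' =>
    hK x₁ (hXK h₁) x₁' (hXK h₁') x₂ (hXK h₂) x₂' (hXK h₂') x₃ (hXK h₃) x₃' (hXK h₃')

/-- **Stub `stub_twistFree_of_blocked` — blocked host ⇒ twisted-corner-free sub-code** (registered
stub of line `SketchIdeator2`, crux `SnSubsetDichotomy.ThresholdSubsetTriples`,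
stmt-MatrixMultiplication-10882; explicit form).  If every solution in `K⁶` of the twisted corner
equation `x₁x₁'⁻¹ τ (x₂x₂'⁻¹) τ (x₃x₃'⁻¹) τ = 1` is trivial or has a non-trivial quotient
`xᵢxᵢ'⁻¹ ∈ B`, and `X ⊆ K` avoids `B` as a quotient, then every solution in `X⁶` is trivial.
Proof term: restrict the host alternative to `X` (`blocked_restrict`), then resolve away the three
blocked branches (`Or.resolve_right`, `not_or`) with `not_blocked_of_avoids` at each coordinate.
[folklore] -/
theorem stub_twistFree_of_blocked : ∀ (n : ℕ) (τ : Equiv.Perm (Fin n)) (K B X : Finset (Equiv.Perm (Fin n))), X ⊆ K → (∀ x₁ ∈ K, ∀ x₁' ∈ K, ∀ x₂ ∈ K, ∀ x₂' ∈ K, ∀ x₃ ∈ K, ∀ x₃' ∈ K, x₁ * x₁'⁻¹ * τ * (x₂ * x₂'⁻¹) * τ * (x₃ * x₃'⁻¹) * τ = 1 → (x₁ = x₁' ∧ x₂ = x₂' ∧ x₃ = x₃') ∨ (x₁ * x₁'⁻¹ ∈ B ∧ x₁ ≠ x₁') ∨ (x₂ * x₂'⁻¹ ∈ B ∧ x₂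 ≠ x₂') ∨ (x₃ * x₃'⁻¹ ∈ B ∧ x₃ ≠ x₃')) → (∀ x ∈ X, ∀ x' ∈ X, x * x'⁻¹ ∈ B → x = x') → ∀ x₁ ∈ X, ∀ x₁' ∈ X, ∀ x₂ ∈ X, ∀ x₂' ∈ X, ∀ x₃ ∈ X, ∀ x₃' ∈ X, x₁ * x₁'⁻¹ * τ * (x₂ * x₂'⁻¹) * τ * (x₃ * x₃'⁻¹) * τ = 1 → x₁ = x₁' ∧ x₂ = x₂' ∧ x₃ = x₃' :=
  fun _n _τ _K _B _X hXK hK hA x₁ h₁ x₁' h₁' x₂ h₂ x₂' h₂' x₃ h₃ x₃' h₃' heq =>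
    (blocked_restrict hXK hK x₁ h₁ x₁' h₁' x₂ h₂ x₂' h₂' x₃ h₃ x₃' h₃' heq).resolve_right
      (not_or.2 ⟨not_blocked_of_avoids hA h₁ h₁',
        not_or.2 ⟨not_blocked_of_avoids hA h₂ h₂', not_blocked_of_avoids hA h₃ h₃'⟩⟩)

end Summit.MatrixMultiplication.MatrixMultiplication.Theorems.ThresholdSubsetTriples.TwistFreeOfBlockedK18
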